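import Literature.AlgebraicGeometry.Hyperkaehler.ReflectionGroupDiscriminantCharacterStable
import Literature.AlgebraicGeometry.Hyperkaehler.ReflectionGroupOrientationCharacter
import HarnessLib

/-!
# Markman's `𝒲^{det·χ}` as a subgroup: `𝒲^{det·χ} ≤ 𝒲 ≤ O⁺`, of index `2` in `𝒲` for `Λ(Kumⁿ)` (`n ≥ 1`) and `Λ(K3^{[n]})` (`n ≥ 3`)
# (Markman, JEMS 25 (2023), §1.1 p. 234 and Thm. 1.4)

Layer `Literature/AlgebraicGeometry/Hyperkaehler`. Written for lane `lit-hodgefound` (Track 2 foundations; prover seat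
`lit-hodgefound-p18`, gen 46, row g46-#13). ONE DEFINITION (`detChiSubgroup`, the tree's set `detChiKer G` of
`GeneralizedKummerMonodromy` packaged as a `Subgroup` of `Aut ℤ^ι`; no named fact, no instance, no notation) and theorems.
Sequel of §7 of `ReflectionGroupDiscriminantCharacterStable.lean` (row g43-#9: `detChiKer` is closed under products and
inverses, contains `1`, the product of two non-members is a member, `ρ_u ∉ detChiKer` for the two lattices of record) and of
`ReflectionGroupOrientationCharacter.lean` (row g46-#3: `𝒲 ≤ O⁺`).

## Source, verbatim (E. Markman, *The monodromy of generalized Kummer varieties …*, JEMS 25 (2023), §1.1 p. 234)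

"Note that `det(r_u) = (u,u)/2` and `χ(r_u) = −(u,u)/2`. Consequently, their product `det·χ` takes `r_u` to `−1`, for both
`+2` and `−2` vectors `u`. Let `𝒲^{det·χ}` be the kernel of `det·χ`. […] **Theorem 1.4.** […] `Mon²(Y) = 𝒲(Λ)^{det·χ}`" (for
`Y` of generalized Kummer type; the tree's named fact `Markman2023_monodromyGroupH2_kummerType` renders Thm. 1.4 with the set
`detChiKer (kumGram n)`).

## Contents (all proved)

* `detChiSubgroup G` (carrier `detChiKer G`), `mem_detChiSubgroup_iff`, `detChiSubgroup_le_reflectionGroup`;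
* **`relIndex_detChiSubgroup_reflectionGroup_eq_two`**: `[𝒲(G) : 𝒲^{det·χ}(G)] = 2` as soon as some `ρ ∈ 𝒲(G)` lies outside the
  kernel (`G` symmetric) — the surjectivity of `det·χ : 𝒲 → {±1}`;
* the lattices of record: `relIndex_detChiSubgroup_kumGram_eq_two` (`n ≥ 1`), `relIndex_detChiSubgroup_k3HilbertGram_eq_two`
  (`n ≥ 3`), and `detChiSubgroup_kumGram_le_orientationPreservingSubgroup` (`Mon²(Kumⁿ) = 𝒲^{det·χ} ≤ O⁺`).

## References

* [Markman2023GeneralizedKummers] E. Markman, The monodromy of generalized Kummer varieties and algebraic cycles on their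
  intermediate Jacobians, JEMS 25 (2023) 231–321: §1.1 p. 234, (1.3)–(1.4), Thm. 1.4.
* [OGrady2021KummerTori] K. O'Grady, Compact tori associated to hyperkähler manifolds of Kummer type, IMRN (2021): Cor. 1.4
  (Mongardi's monodromy dichotomy).
-/

noncomputable section

open Module Function Matrix
open LinearMap (BilinForm)

namespace Literature.AlgebraicGeometry.Hyperkaehler

variable {ι : Type} [Fintype ι] [DecidableEq ι]

/-- **Markman's `𝒲^{det·χ} = ker(det·χ : 𝒲 → {±1})`** as a subgroup of `Aut ℤ^ι`: the elements `g ∈ 𝒲(G)` with `det g = χ(g)`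
(`det g = 1` and `ḡ = id`, or `det g = −1` and `ḡ = −id`) — the tree's set `detChiKer G` with its group structure
(`one_mem_detChiKer`, `mul_mem_detChiKer`, `inv_mem_detChiKer`). [cite: Markman2023GeneralizedKummers, §1.1 p. 234 ("Let 𝒲^{det·χ} be the kernel of det·χ")] -/
def detChiSubgroup (G : Matrix ι ι ℤ) : Subgroup ((ι → ℤ) ≃ₗ[ℤ] (ι → ℤ)) where
  carrier := detChiKer G
  mul_mem' := mul_mem_detChiKer
  one_mem' := one_mem_detChiKer G
  inv_mem' := inv_mem_detChiKer

/-- Unfolding of `detChiSubgroup`. [cite: Markman2023GeneralizedKummers, §1.1 p. 234] -/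
theorem mem_detChiSubgroup_iff (G : Matrix ι ι ℤ) (g : (ι → ℤ) ≃ₗ[ℤ] (ι → ℤ)) :
    g ∈ detChiSubgroup G ↔ g ∈ detChiKer G :=
  Iff.rfl

/-- **`𝒲^{det·χ} ≤ 𝒲`.** [cite: Markman2023GeneralizedKummers, §1.1 p. 234] -/
theorem detChiSubgroup_le_reflectionGroup (G : Matrix ι ι ℤ) : detChiSubgroup G ≤ reflectionGroup G :=
  fun _ hg ↦ hg.1

/-- **`[𝒲 : 𝒲^{det·χ}] = 2`** as soon as some `ρ ∈ 𝒲(G)` has `det·χ(ρ) = −1` (`G` symmetric): `det·χ` is then a surjective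
character onto `{±1}` ("their product `det·χ` takes `r_u` to `−1`"). [cite: Markman2023GeneralizedKummers, §1.1 p. 234] -/
theorem relIndex_detChiSubgroup_reflectionGroup_eq_two {G : Matrix ι ι ℤ} (hG : G.transpose = G)
    (h : ∃ ρ ∈ reflectionGroup G, ρ ∉ detChiKer G) :
    (detChiSubgroup G).relIndex (reflectionGroup G) = 2 := by
  obtain ⟨ρ, hρ, hρ'⟩ := h
  rw [Subgroup.relIndex, Subgroup.index_eq_two_iff]
  refine ⟨⟨ρ, hρ⟩, fun b ↦ ?_⟩
  rw [Subgroup.mem_subgroupOf, Subgroup.mem_subgroupOf, xor_def]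
  change (((b : (ι → ℤ) ≃ₗ[ℤ] (ι → ℤ)) * ρ ∈ detChiKer G) ∧ ¬ ((b : (ι → ℤ) ≃ₗ[ℤ] (ι → ℤ)) ∈ detChiKer G)) ∨
    (((b : (ι → ℤ) ≃ₗ[ℤ] (ι → ℤ)) ∈ detChiKer G) ∧ ¬ ((b : (ι → ℤ) ≃ₗ[ℤ] (ι → ℤ)) * ρ ∈ detChiKer G))
  by_cases hb : (b : (ι → ℤ) ≃ₗ[ℤ] (ι → ℤ)) ∈ detChiKer G
  · refine Or.inr ⟨hb, fun hbρ ↦ hρ' ?_⟩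
    have h1 := mul_mem_detChiKer (inv_mem_detChiKer hb) hbρ
    rwa [inv_mul_cancel_left] at h1
  · exact Or.inl ⟨mul_mem_detChiKer_of_not_mem hG b.2 hρ hb hρ', hb⟩

/-- **`[𝒲(Λ(Kumⁿ)) : 𝒲^{det·χ}] = 2`** for `kumGram n`, `n ≥ 1` (`ρ_u ∉ 𝒲^{det·χ}` for a `(+2)`-vector `u`): Markman's
`Mon²(Kumⁿ) = 𝒲^{det·χ}` is an index-two subgroup of `𝒲`. [cite: Markman2023GeneralizedKummers, §1.1 p. 234 and Thm. 1.4] [cite: OGrady2021KummerTori, Cor. 1.4] -/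
theorem relIndex_detChiSubgroup_kumGram_eq_two {n : ℕ} (hn : 1 ≤ n) :
    (detChiSubgroup (kumGram n)).relIndex (reflectionGroup (kumGram n)) = 2 :=
  relIndex_detChiSubgroup_reflectionGroup_eq_two (kumGram_transpose n)
    (exists_mem_reflectionGroup_not_mem_detChiKer_kumGram hn)

/-- **`[𝒲(Λ(K3^{[n]})) : 𝒲^{det·χ}] = 2`** for `k3HilbertGram n`, `n ≥ 3` (rank `23` odd, `A ≅ ℤ/(2n−2)` has an element `a ≠ −a`).
[cite: Markman2023GeneralizedKummers, §1.1 p. 234 ("for both +2 and −2 vectors u")] -/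
theorem relIndex_detChiSubgroup_k3HilbertGram_eq_two {n : ℕ} (hn : 3 ≤ n) :
    (detChiSubgroup (k3HilbertGram n)).relIndex (reflectionGroup (k3HilbertGram n)) = 2 :=
  relIndex_detChiSubgroup_reflectionGroup_eq_two (k3HilbertGram_transpose n)
    (exists_mem_reflectionGroup_not_mem_detChiKer_k3HilbertGram hn)

/-- **`Mon²(Kumⁿ) = 𝒲^{det·χ} ≤ O⁺(Λ(Kumⁿ))`**: the kernel consists of orientation-preserving isometries.
[cite: Markman2023GeneralizedKummers, §1.1 (1.3) and Thm. 1.4] -/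
theorem detChiSubgroup_kumGram_le_orientationPreservingSubgroup (n : ℕ) :
    detChiSubgroup (kumGram n) ≤ orientationPreservingSubgroup (kumGram n) (kumGram_transpose n) :=
  fun _ hg ↦ mem_orientationPreservingSubgroup_of_mem_detChiKer_kumGram n hg

/-- **`𝒲^{det·χ}(Λ(K3^{[n]})) ≤ O⁺`** (`n ≥ 2`). [cite: Markman2023GeneralizedKummers, §1.1 (1.3)] [cite: Markman2011Survey, §9.1.1 (9.1)] -/
theorem detChiSubgroup_k3HilbertGram_le_orientationPreservingSubgroup {n : ℕ} (hn : 2 ≤ n) :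
    detChiSubgroup (k3HilbertGram n) ≤ orientationPreservingSubgroup (k3HilbertGram n) (k3HilbertGram_transpose n) :=
  fun _ hg ↦ reflectionGroup_k3HilbertGram_le_orientationPreservingSubgroup hn hg.1

end Literature.AlgebraicGeometry.Hyperkaehler

end
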